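import Summits.RiemannHypothesis.RiemannHypothesis.Theorems.WeilGroundStateGroundStatesConvergeToXiHarmonicClosure
import Literature.NumberTheory.LFunctions.WeilMellinInversion
import Literature.NumberTheory.LFunctions.ZetaZerosProofs
import Literature.Barriers.RiemannHypothesis.DeBrangesPositivityHE
import Mathlib.Analysis.Calculus.DSlope
import Mathlib.Analysis.Analytic.IsolatedZeros
import Mathlib.Analysis.Complex.CauchyIntegral
import HarnessLib

/-!
# HANDOFF — the bridge from VALUES to MULTIPLICITIES: under simple zeros, Weil-harmonic ⟹ `ξ ∣ v̂` (file XX-c)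

Cell `rh-explicit`, TRACK «HANDOFF» (ROUTE 1′), seat theory-1 (H-T, statement owner), gen18. RH-free, SZC as
an explicit hypothesis where used; Mathlib + built tree files of the crux line `GroundStatesConvergeToXi`
(stmt-RiemannHypothesis-1527). No definitions. Companion of XX-a `HandoffGaussTail` (p388517) and XX-b
`HandoffHardyRigiditySimpleZeros` (staged): HANDOFF-STATEMENT §J.33, LOGIC-CARD item 4⁗′.

CONTEXT. idea-3 g24 offered «Hardy rigidity» H-RIG over the tree's Weil-harmonic predicate
(`∀ g, IsWeilTest g → weilFunctional (weilConv v (weilReflect g)) = 0`); idea-3 g25 split it into the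
VALUE version `HRigValue` (that predicate), the DIVISIBILITY version `HRig` (hypothesis `ξ ∣ v̂`:
`∃ m, Differentiable ℂ m ∧ ∀ s, weilMellin v s = m s * riemannXi s`), and the bridge
`HarmonicDivides D := ∀ v, Measurable v → GaussTail D v → IsWeilHarmonic v → XiDivides v`. XX-b shows the
bridge FAILS at any multiple zero of `ξ` (so the value version is ≥ SZC). This file proves the converse
half, turning idea-3 g25's «TRUE if every non-trivial zero that v̂ meets is simple» (DERIVED) into KERNEL:

* §1 the order-2 rate-`π` Gaussian tail is super-exponential (`exists_norm_le_exp_neg_of_gaussTail`: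
  `O(e^{−c|t|})` for every `c`; exponential moments of every order, `integrable_norm_mul_exp_of_gaussTail`);
* §2 hence `v̂ = weilMellin v` is ENTIRE for measurable `v` in the class
  (`hasDerivAt_weilMellin_of_expMoments`, differentiation under the integral as in the tree's
  `IsWeilGroundState.hasDerivAt_weilMellin`, without the window);
* §3 `exists_entire_quotient_of_simple_zeros`: an entire `V` vanishing on the zero set of `ξ` is `m·ξ` with
  `m` entire as soon as every zero of `ξ` is simple (`m = V/ξ` off the zeros, `= V′/ξ′` at them; near a
  zero `m = dslope V ρ / dslope ξ ρ`, analytic by `HasFPowerSeriesAt.has_fpower_series_dslope_fslope`);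
* §4 **`harmonicDivides_two_of_simple_zeros`**: if `ξ′(ρ) ≠ 0` at every non-trivial zero then idea-3 g25's
  `HarmonicDivides 2` (unfolded verbatim) HOLDS — `v̂` is entire (§2), vanishes at every non-trivial zero
  by the tree's `harmonic_closure` (VALUES), the zeros of `ξ` are exactly those (`riemannXi_eq_zero_iff`),
  and §3 divides; `harmonicDivides_two_of_simpleZerosConjecture` is the same from `SimpleZerosConjecture`
  (`ξ′ = A·ζ′`, `deriv_riemannXi_eq_of_zero`).

READING (LOGIC-CARD 4⁗′). Together with XX-b: **`HarmonicDivides 2` ⟺ «ξ′ ≠ 0 at every non-trivial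
zero» ⟺ SimpleZerosConjecture** — the gap between the value-level Hardy rigidity (the offer; ≥ SZC) and the
divisibility-level one (`HRig`, classical, SZC-free, untouched here) is EXACTLY the Simple Zeros
Conjecture; Weil's functional sees values at the zeros, never multiplicities. SZC and RH are incomparable;
nothing here bears on the truth of RH.

References: idea-3 IDEAS-finite-rank PART G24 §G24-3, PART G25 (HOME `handoff/idea-3/g25/lean/
HandoffHardyRigidity.lean`, not in the tree); Bombieri 2000 §4 (entire Mellin transforms)
[cite: Bombieri2000Weil, §4 Lemma 4]; the tree's `…HarmonicClosure`, `WeilMellinInversion`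
(`hasDerivAt_weilIntegrand`); `RHWave0.SimpleZerosConjecture`.
-/

set_option linter.dupNamespace false  -- the mandated namespace repeats `RiemannHypothesis`

noncomputable section

open Set Filter MeasureTheory Complex
open scoped Topology Real
open Literature.NumberTheory.LFunctions
open Summit.RiemannHypothesis.RiemannHypothesis.Theorems.GroundStatesConvergeToXi

namespace Summit.RiemannHypothesis.RiemannHypothesis.Theorems.HandoffHarmonicDivides

/-! ## §1 The rate-`π` Gaussian tail is super-exponential -/

/-- The order-2 rate-`π` Gaussian envelope beats every exponential:
`C(1+e^{2|t|})² e^{|t|/2 − πe^{2|t|}} ≤ 4|C| e^{−π + c²/(8π)} · e^{−c|t|}` (from `e^{2|t|} ≥ 1 + 2|t| + 2t²`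
and `2πt² − c|t| + c²/(8π) ≥ 0`). [folklore] -/
theorem gaussEnv_le_exp_neg (C c : ℝ) (t : ℝ) :
    C * (1 + Real.exp (2 * |t|)) ^ 2 * Real.exp (|t| / 2 - π * Real.exp (2 * |t|)) ≤
      4 * |C| * Real.exp (-π + c ^ 2 / (8 * π)) * Real.exp (-(c * |t|)) := by
  set u : ℝ := |t| with hu
  have hu0 : 0 ≤ u := abs_nonneg t
  have h1 : (1 + Real.exp (2 * u)) ^ 2 ≤ 4 * Real.exp (4 * u) := by
    have h4 : Real.exp (4 * u) = Real.exp (2 * u) ^ 2 := by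
      rw [← Real.exp_nat_mul]; congr 1; ring
    rw [h4]; nlinarith [Real.exp_pos (2 * u), Real.one_le_exp (by positivity : 0 ≤ 2 * u)]
  have h2 : 1 + 2 * u + 2 * u ^ 2 ≤ Real.exp (2 * u) := by
    have h := Real.quadratic_le_exp_of_nonneg (by positivity : (0:ℝ) ≤ 2 * u)
    nlinarith
  have h8 : 0 < 8 * π := by positivity
  have hX : 8 * π * (2 * π * u ^ 2 - c * u + c ^ 2 / (8 * π)) = (4 * π * u - c) ^ 2 := by
    field_simp; ring
  have hsq : 0 ≤ 2 * π * u ^ 2 - c * u + c ^ 2 / (8 * π) :=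
    (mul_nonneg_iff_of_pos_left h8).1 (by rw [hX]; exact sq_nonneg _)
  have h3 : Real.exp (4 * u) * Real.exp (u / 2 - π * Real.exp (2 * u)) ≤
      Real.exp (-π + c ^ 2 / (8 * π)) * Real.exp (-(c * u)) := by
    rw [← Real.exp_add, ← Real.exp_add, Real.exp_le_exp]
    have hπE := mul_le_mul_of_nonneg_left h2 Real.pi_pos.le
    nlinarith [Real.pi_gt_three]
  calc C * (1 + Real.exp (2 * u)) ^ 2 * Real.exp (u / 2 - π * Real.exp (2 * u))
      ≤ |C| * (1 + Real.exp (2 * u)) ^ 2 * Real.exp (u / 2 - π * Real.exp (2 * u)) := by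
        gcongr; exact le_abs_self C
    _ ≤ |C| * (4 * Real.exp (4 * u)) * Real.exp (u / 2 - π * Real.exp (2 * u)) := by gcongr
    _ = 4 * |C| * (Real.exp (4 * u) * Real.exp (u / 2 - π * Real.exp (2 * u))) := by ring
    _ ≤ 4 * |C| * (Real.exp (-π + c ^ 2 / (8 * π)) * Real.exp (-(c * u))) :=
        mul_le_mul_of_nonneg_left h3 (by positivity)
    _ = _ := by ring

/-- A function with the order-2 rate-`π` Gaussian tail is `O(e^{−c|t|})` for EVERY `c`. [folklore] -/
theorem exists_norm_le_exp_neg_of_gaussTail {v : ℝ → ℂ} {C : ℝ}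
    (hv : ∀ t, ‖v t‖ ≤ C * (1 + Real.exp (2 * |t|)) ^ 2 * Real.exp (|t| / 2 - π * Real.exp (2 * |t|)))
    (c : ℝ) : ∃ K : ℝ, 0 ≤ K ∧ ∀ t, ‖v t‖ ≤ K * Real.exp (-(c * |t|)) :=
  ⟨4 * |C| * Real.exp (-π + c ^ 2 / (8 * π)), by positivity,
    fun t => (hv t).trans (gaussEnv_le_exp_neg C c t)⟩

/-- Exponential moments of every order: `∫ ‖v(t)‖ e^{A|t|} dt < ∞` for every `A`, for a measurable `v`
with the Gaussian tail. [folklore] -/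
theorem integrable_norm_mul_exp_of_gaussTail {v : ℝ → ℂ} (hm : AEStronglyMeasurable v volume) {C : ℝ}
    (hv : ∀ t, ‖v t‖ ≤ C * (1 + Real.exp (2 * |t|)) ^ 2 * Real.exp (|t| / 2 - π * Real.exp (2 * |t|)))
    (A : ℝ) : Integrable fun t : ℝ => ‖v t‖ * Real.exp (A * |t|) := by
  obtain ⟨K, hK0, hK⟩ := exists_norm_le_exp_neg_of_gaussTail hv (|A| + 1)
  have hgI : Integrable (fun t : ℝ => K * Real.exp (-(1 : ℝ) * |t|)) :=
    (Literature.Analysis.Complex.integrable_exp_neg_mul_abs (by norm_num : (0:ℝ) < 1)).const_mul K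
  refine hgI.mono' (hm.norm.mul (by fun_prop)) (ae_of_all _ fun t => ?_)
  rw [Real.norm_eq_abs, abs_of_nonneg (by positivity)]
  calc ‖v t‖ * Real.exp (A * |t|) ≤ K * Real.exp (-((|A| + 1) * |t|)) * Real.exp (A * |t|) :=
        mul_le_mul_of_nonneg_right (hK t) (Real.exp_pos _).le
    _ = K * Real.exp (-((|A| + 1) * |t|) + A * |t|) := by rw [mul_assoc, ← Real.exp_add]
    _ ≤ K * Real.exp (-(1 : ℝ) * |t|) := by
        refine mul_le_mul_of_nonneg_left (Real.exp_le_exp.2 ?_) hK0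
        nlinarith [le_abs_self A, abs_nonneg t]

/-! ## §2 The transform of a super-exponentially small function is entire -/

/-- **`v̂ = weilMellin v` is entire** when `v` is measurable with exponential moments of every order
(differentiation under the integral, dominated on `‖s − s₀‖ < 1` by `‖v(t)‖ |t| e^{(‖s₀‖+2)|t|}`; the
tree's `IsWeilGroundState.hasDerivAt_weilMellin` pattern without the window). [folklore] -/
theorem hasDerivAt_weilMellin_of_expMoments {v : ℝ → ℂ} (hm : AEStronglyMeasurable v volume)
    (hI : ∀ A : ℝ, Integrable fun t : ℝ => ‖v t‖ * Real.exp (A * |t|)) (s₀ : ℂ) :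
    HasDerivAt (weilMellin v) (∫ t : ℝ, v t * (t * cexp ((s₀ - 1 / 2) * t))) s₀ := by
  set A : ℝ := ‖s₀‖ + 2 with hA
  have hdom : ∀ s ∈ Metric.ball s₀ 1, ∀ t : ℝ, ((s - 1 / 2) * (t : ℂ)).re ≤ A * |t| := by
    intro s hs t
    have hre : ((s - 1 / 2) * (t : ℂ)).re = (s.re - 1 / 2) * t := by simp [sub_re, mul_re]
    rw [hre]
    have hs' : ‖s - s₀‖ < 1 := by rwa [Metric.mem_ball, dist_eq_norm] at hs
    have h3 : |s.re - 1 / 2| ≤ A := by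
      have e : s.re - 1 / 2 = (s - s₀).re + s₀.re + (-(1 / 2)) := by simp; ring
      rw [e, hA]
      refine (abs_add_three _ _ _).trans ?_
      rw [abs_neg, abs_of_pos (by norm_num : (0 : ℝ) < 1 / 2)]
      linarith [abs_re_le_norm (s - s₀), abs_re_le_norm s₀]
    calc (s.re - 1 / 2) * t ≤ |(s.re - 1 / 2) * t| := le_abs_self _
      _ = |s.re - 1 / 2| * |t| := abs_mul _ _
      _ ≤ A * |t| := mul_le_mul_of_nonneg_right h3 (abs_nonneg _)
  have hF_meas : ∀ᶠ s in 𝓝 s₀,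
      AEStronglyMeasurable (fun t : ℝ => v t * cexp ((s - 1 / 2) * t)) volume :=
    Eventually.of_forall fun s =>
      hm.mul (by fun_prop : Continuous fun t : ℝ => cexp ((s - 1 / 2) * t)).aestronglyMeasurable
  have hF_int : Integrable (fun t : ℝ => v t * cexp ((s₀ - 1 / 2) * t)) := by
    refine (hI A).mono' (hm.mul (by fun_prop : Continuous fun t : ℝ =>
      cexp ((s₀ - 1 / 2) * t)).aestronglyMeasurable) (ae_of_all _ fun t => ?_)
    rw [norm_mul, Complex.norm_exp]
    exact mul_le_mul_of_nonneg_left (Real.exp_le_exp.2 (hdom s₀ (Metric.mem_ball_self one_pos) t))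
      (norm_nonneg _)
  have hF'_meas :
      AEStronglyMeasurable (fun t : ℝ => v t * (t * cexp ((s₀ - 1 / 2) * t))) volume :=
    hm.mul
      (by fun_prop : Continuous fun t : ℝ => (t : ℂ) * cexp ((s₀ - 1 / 2) * t)).aestronglyMeasurable
  have h_bound : ∀ᵐ t : ℝ, ∀ s ∈ Metric.ball s₀ 1,
      ‖v t * (t * cexp ((s - 1 / 2) * t))‖ ≤ ‖v t‖ * Real.exp ((A + 1) * |t|) := by
    refine Eventually.of_forall fun t s hs => ?_
    rw [norm_mul, norm_mul, Complex.norm_exp, Complex.norm_real, Real.norm_eq_abs]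
    refine mul_le_mul_of_nonneg_left ?_ (norm_nonneg _)
    have h1 : |t| ≤ Real.exp (1 * |t|) := by
      rw [one_mul]; exact (Real.add_one_le_exp |t|).trans' (by linarith [abs_nonneg t])
    calc |t| * Real.exp ((s - 1 / 2) * (t : ℂ)).re ≤ Real.exp (1 * |t|) * Real.exp (A * |t|) :=
          mul_le_mul h1 (Real.exp_le_exp.2 (hdom s hs t)) (Real.exp_pos _).le (Real.exp_pos _).le
      _ = Real.exp ((A + 1) * |t|) := by rw [← Real.exp_add]; congr 1; ring
  have h_diff : ∀ᵐ t : ℝ, ∀ s ∈ Metric.ball s₀ 1,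
      HasDerivAt (fun s : ℂ => v t * cexp ((s - 1 / 2) * t))
        (v t * (t * cexp ((s - 1 / 2) * t))) s :=
    Eventually.of_forall fun t s _ => hasDerivAt_weilIntegrand v t s
  exact (hasDerivAt_integral_of_dominated_loc_of_deriv_le (Metric.ball_mem_nhds s₀ one_pos)
    hF_meas hF_int hF'_meas h_bound (hI (A + 1)) h_diff).2

/-- `v̂` is entire for a measurable `v` with the order-2 rate-`π` Gaussian tail. [folklore] -/
theorem differentiable_weilMellin_of_gaussTail {v : ℝ → ℂ} (hm : AEStronglyMeasurable v volume)
    {C : ℝ}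
    (hv : ∀ t, ‖v t‖ ≤ C * (1 + Real.exp (2 * |t|)) ^ 2 * Real.exp (|t| / 2 - π * Real.exp (2 * |t|))) :
    Differentiable ℂ (weilMellin v) := fun s =>
  (hasDerivAt_weilMellin_of_expMoments hm (integrable_norm_mul_exp_of_gaussTail hm hv) s).differentiableAt

/-! ## §3 Removable singularities: an entire function vanishing on the zero set of `ξ` is divisible by
`ξ` when those zeros are simple -/

/-- **Division by `ξ` at simple zeros.** If `V` is entire and vanishes at every zero of `ξ`, and every
zero of `ξ` is simple (`ξ′ ≠ 0` there), then `V = m·ξ` with `m` entire: `m = V/ξ` off the zeros and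
`m = V′/ξ′` at the zeros (near a zero `ρ`, `m = dslope V ρ / dslope ξ ρ`, a quotient of analytic functions
with non-vanishing denominator). [folklore] -/
theorem exists_entire_quotient_of_simple_zeros {V : ℂ → ℂ} (hV : Differentiable ℂ V)
    (hVz : ∀ s : ℂ, riemannXi s = 0 → V s = 0)
    (hS : ∀ s : ℂ, riemannXi s = 0 → deriv riemannXi s ≠ 0) :
    ∃ m : ℂ → ℂ, Differentiable ℂ m ∧ ∀ s : ℂ, V s = m s * riemannXi s := by
  classical
  set m : ℂ → ℂ := fun s =>
    if riemannXi s = 0 then deriv V s / deriv riemannXi s else V s / riemannXi s with hm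
  refine ⟨m, fun s₀ => ?_, fun s => ?_⟩
  · by_cases h0 : riemannXi s₀ = 0
    · -- at a (simple) zero: `m = dslope V s₀ / dslope ξ s₀` near `s₀`
      obtain ⟨p, hp⟩ := hV.analyticAt s₀
      obtain ⟨q, hq⟩ := differentiable_riemannXi.analyticAt s₀
      have ha : AnalyticAt ℂ (dslope V s₀) s₀ := ⟨_, hp.has_fpower_series_dslope_fslope⟩
      have hb : AnalyticAt ℂ (dslope riemannXi s₀) s₀ := ⟨_, hq.has_fpower_series_dslope_fslope⟩
      have hb0 : dslope riemannXi s₀ s₀ ≠ 0 := by rw [dslope_same]; exact hS s₀ h0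
      have hbne : ∀ᶠ s in 𝓝 s₀, dslope riemannXi s₀ s ≠ 0 := hb.continuousAt.eventually_ne hb0
      have hev : m =ᶠ[𝓝 s₀] fun s => dslope V s₀ s / dslope riemannXi s₀ s := by
        filter_upwards [hbne] with s hs
        by_cases hss : s = s₀
        · subst hss
          simp only [hm, h0, if_true, dslope_same]
        · have hξ : riemannXi s = (s - s₀) * dslope riemannXi s₀ s := by
            have h := sub_smul_dslope riemannXi s₀ s
            rw [smul_eq_mul, h0, sub_zero] at h
            exact h.symm
          have hVs : V s = (s - s₀) * dslope V s₀ s := by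
            have h := sub_smul_dslope V s₀ s
            rw [smul_eq_mul, hVz s₀ h0, sub_zero] at h
            exact h.symm
          have hξne : riemannXi s ≠ 0 := by
            rw [hξ]; exact mul_ne_zero (sub_ne_zero.2 hss) hs
          simp only [hm, hξne, if_false]
          rw [hVs, hξ, mul_div_mul_left _ _ (sub_ne_zero.2 hss)]
      exact ((ha.differentiableAt).div hb.differentiableAt hb0).congr_of_eventuallyEq hev
    · -- off the zeros: `m = V/ξ` near `s₀`
      have hne : ∀ᶠ s in 𝓝 s₀, riemannXi s ≠ 0 :=
        differentiable_riemannXi.continuous.continuousAt.eventually_ne h0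
      have hev : m =ᶠ[𝓝 s₀] fun s => V s / riemannXi s := by
        filter_upwards [hne] with s hs
        simp only [hm, hs, if_false]
      exact ((hV s₀).div (differentiable_riemannXi s₀) h0).congr_of_eventuallyEq hev
  · by_cases h0 : riemannXi s = 0
    · rw [h0, mul_zero, hVz s h0]
    · simp only [hm, h0, if_false]; rw [div_mul_cancel₀ _ h0]

/-! ## §4 The bridge: under simple zeros, Weil-harmonic ⟹ `ξ ∣ v̂` -/

/-- **Under simple zeros, a Weil-harmonic function of the rate-`π` class has `v̂ = m·ξ`, `m` ENTIRE.**
If every non-trivial zero `ρ` of `ζ` has `ξ′(ρ) ≠ 0`, then for every measurable `v` with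
`‖v(t)‖ ≤ C(1+e^{2|t|})² e^{|t|/2 − πe^{2|t|}}` which is Weil-harmonic (`W(v ⋆ g̃) = 0` for all tests `g`),
there is an entire `m` with `weilMellin v = m · riemannXi`: `v̂` is entire (§2), vanishes at every
non-trivial zero (the tree's `harmonic_closure` — VALUES), the zeros of `ξ` are exactly those
(`riemannXi_eq_zero_iff`), and simple zeros make the singularities of `v̂/ξ` removable (§3). [folklore] -/
theorem exists_entire_quotient_of_harmonic {v : ℝ → ℂ} (hm : Measurable v) {C : ℝ}
    (hv : ∀ t, ‖v t‖ ≤ C * (1 + Real.exp (2 * |t|)) ^ 2 * Real.exp (|t| / 2 - π * Real.exp (2 * |t|)))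
    (hharm : ∀ g : ℝ → ℂ, IsWeilTest g → weilFunctional (weilConv v (weilReflect g)) = 0)
    (hS : ∀ ρ : ℂ, ρ ∈ ZetaZeros.riemannZetaNontrivialZeros → deriv riemannXi ρ ≠ 0) :
    ∃ m : ℂ → ℂ, Differentiable ℂ m ∧ ∀ s : ℂ, weilMellin v s = m s * riemannXi s := by
  have hma : AEStronglyMeasurable v volume := hm.aestronglyMeasurable
  have hξz : ∀ s : ℂ, riemannXi s = 0 → s ∈ ZetaZeros.riemannZetaNontrivialZeros := fun s hs =>
    mem_riemannZetaNontrivialZeros_iff_holds.2 ((riemannXi_eq_zero_iff_holds s).1 hs)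
  refine exists_entire_quotient_of_simple_zeros (differentiable_weilMellin_of_gaussTail hma hv)
    (fun s hs => ?_) (fun s hs => hS s (hξz s hs))
  exact harmonic_closure hma (by norm_num : (1:ℝ) / 2 < 3 / 4)
    (integrable_norm_mul_exp_of_gaussTail hma hv (3 / 4)) hharm (hξz s hs)

/-- **idea-3 g25's bridge `HarmonicDivides 2`, unfolded verbatim, HOLDS under simple zeros.** With file
XX-b's `not_harmonicDivides_two_of_multiple_zero` (it FAILS at any multiple zero): `HarmonicDivides 2`
⟺ «`ξ′(ρ) ≠ 0` at every non-trivial zero `ρ`» ⟺ `SimpleZerosConjecture` — the gap between the VALUE-level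
Hardy rigidity (idea-3 g24's offer, ≥ SZC) and the divisibility-level one (`HRig`, SZC-free) is EXACTLY
the Simple Zeros Conjecture. [folklore] -/
theorem harmonicDivides_two_of_simple_zeros
    (hS : ∀ ρ : ℂ, ρ ∈ ZetaZeros.riemannZetaNontrivialZeros → deriv riemannXi ρ ≠ 0) :
    ∀ v : ℝ → ℂ, Measurable v →
      (∃ C : ℝ, ∀ t : ℝ,
        ‖v t‖ ≤ C * (1 + Real.exp (2 * |t|)) ^ 2 * Real.exp (|t| / 2 - π * Real.exp (2 * |t|))) →
      (∀ g : ℝ → ℂ, IsWeilTest g → weilFunctional (weilConv v (weilReflect g)) = 0) →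
      ∃ m : ℂ → ℂ, Differentiable ℂ m ∧ ∀ s : ℂ, weilMellin v s = m s * riemannXi s :=
  fun _ hm ⟨_, hv⟩ hharm => exists_entire_quotient_of_harmonic hm hv hharm hS

/-- The same from the tree's `SimpleZerosConjecture` (`ζ′(ρ) ≠ 0`; `ξ′(ρ) = A(ρ)ζ′(ρ)` with `A(ρ) ≠ 0`,
`deriv_riemannXi_eq_of_zero`). [folklore] -/
theorem harmonicDivides_two_of_simpleZerosConjecture (hS : SimpleZerosConjecture) :
    ∀ v : ℝ → ℂ, Measurable v →
      (∃ C : ℝ, ∀ t : ℝ,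
        ‖v t‖ ≤ C * (1 + Real.exp (2 * |t|)) ^ 2 * Real.exp (|t| / 2 - π * Real.exp (2 * |t|))) →
      (∀ g : ℝ → ℂ, IsWeilTest g → weilFunctional (weilConv v (weilReflect g)) = 0) →
      ∃ m : ℂ → ℂ, Differentiable ℂ m ∧ ∀ s : ℂ, weilMellin v s = m s * riemannXi s := by
  refine harmonicDivides_two_of_simple_zeros fun ρ hρ hξ' => ?_
  obtain ⟨hζ, h0, -⟩ := mem_riemannZetaNontrivialZeros_iff_holds.1 hρ
  have hne1 : ρ ≠ 1 := ZetaZeros.riemannZetaNontrivialZeros.ne_one hρ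
  rw [Literature.Barriers.RiemannHypothesis.deriv_riemannXi_eq_of_zero h0 hne1 hζ] at hξ'
  exact (mul_eq_zero.1 hξ').elim (Literature.Barriers.RiemannHypothesis.xiFactor_ne_zero h0 hne1)
    (hS ρ hρ)

end Summit.RiemannHypothesis.RiemannHypothesis.Theorems.HandoffHarmonicDivides

end
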